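import Mathlib
import Literature.NumberTheory.Transcendental.ZagierDilogarithmConjecture
import Literature.NumberTheory.Transcendental.BlochWignerDilogarithm
import Literature.NumberTheory.Transcendental.BlochWignerDilogarithmProofs
import Literature.NumberTheory.Transcendental.BlochGroupRegulator
import Summits.KontsevichZagierPeriods.KontsevichZagierPeriods.Theorems.ZagierDilogarithmConjecture.Negative.DehnInvariant
import Summits.KontsevichZagierPeriods.KontsevichZagierPeriods.Theorems.HyperbolicBlochZagierDilogarithmConjectureNumberFieldDescent
import Summits.KontsevichZagierPeriods.KontsevichZagierPeriods.Theorems.HyperbolicBlochZagierDilogarithmConjectureStubAbelianSectorIff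
import Summits.KontsevichZagierPeriods.KontsevichZagierPeriods.Theorems.HyperbolicBlochZagierDilogarithmConjectureStubAbelianPropagation
import HarnessLib

/-!
# `ZagierDilogarithmConjecture` (stmt-KontsevichZagierPeriods-10550) — line
`kummer-clausen-linearisation` (reshape c5, "the cyclotomic tower and the abelian sector"),
stub `stub_abelianSectorTorsion_of_milnor`

**The abelian Dehn-zero sector of Zagier's conjecture, in TORSION form, under Borel's theorem
alone.** Notation: `ζ_N = e^{2πi/N}`, `D` the Bloch–Wigner dilogarithm (`blochWignerDilog`),
`R̄ = ⟨dilogRelators⟩` the relator group of Zagier's dilogarithm conjecture (Neumann 1998, §2.1),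
`dehn u v` the Dehn-type invariants of `Negative/DehnInvariant`.

GIVEN both halves of Borel's theorem for the Bloch group of a number field — the torsion kernel of
the regulator (`Borel1977_blochGroup_regulator_kernel_torsion`) and the rank bound
(`Borel1977_blochGroup_rank_le`), both named printed facts carried as explicit hypotheses and never
unfolded — and Milnor's conjecture at level `N` (the Clausen values `D(ζ_N^c)`, `(c, N) = 1`,
`0 < c < N/2`, admit only the trivial `ℤ`-relation): every Dehn-zero `ℤ`-relation
`Σ nᵢ D(zᵢ) = 0` among cyclotomic points `zᵢ = Σₘ qᵢₘ ζ_Nᵐ ∈ ℍ⁺` is explained UP TO TORSION,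
i.e. `M • Σ nᵢ[zᵢ] ∈ R̄` for some `M ≥ 1`. No Dupont/Suslin criterion is used: this is the purely
Borel-conditional form of the abelian sector, the input of the line's torsion descent.

Proof: a one-line composition. The lead's abelian propagation `stub_abelianPropagation` (rank half
of Borel + Milnor_N) turns the Dehn-zero relation into the vanishing of every Galois-twisted
anti-symmetrised regulator `Σ nᵢ (D(σ zᵢ) − D(σ z̄ᵢ)) = 0`, `σ : ℚ̄ → ℂ`; the cyclotomic
combinations `zᵢ` are algebraic (`AbelianSector.isAlgebraic_cyclotomicSum`), so generation 2's
descent to a number field `stub_numberFieldDescent` (torsion-kernel half of Borel) yields the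
positive multiple in `R̄`. Sorry-free; axioms ⊆ {propext, Classical.choice, Quot.sound};
conditional only on the explicit antecedents.

## References

* W. D. Neumann, *Hilbert's 3rd problem and invariants of 3-manifolds*, Geom. Topol. Monogr. 1
  (1998), §2.1 and Thm. 3.2. [Neumann1998]
* J. Milnor, *Hyperbolic geometry: the first 150 years*, Bull. AMS 6 (1982), Appendix.
  [Milnor1982]
-/

noncomputable section

open scoped BigOperators ComplexConjugate
open Literature.NumberTheory.Transcendental
open Summit.KontsevichZagierPeriods.HyperbolicBloch.ZagierDilogarithmConjectureNegative (dehn)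
open Summit.KontsevichZagierPeriods.HyperbolicBloch.ZagierDilogarithm (stub_numberFieldDescent)

namespace Summit.KontsevichZagierPeriods.HyperbolicBloch.ZagierDilogarithmCyclotomic

open AbelianSector (isAlgebraic_cyclotomicSum)

/-- **Stub `stub_abelianSectorTorsion_of_milnor`: the abelian Dehn-zero sector in torsion form,
under Borel alone.** Given both halves of Borel's theorem for the Bloch group (torsion regulator
kernel and rank bound) and Milnor's conjecture at level `N`, every Dehn-zero relation
`Σ nᵢ D(zᵢ) = 0` among cyclotomic points `zᵢ = Σₘ qᵢₘ ζ_Nᵐ ∈ ℍ⁺` has a positive multiple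
`M • Σ nᵢ[zᵢ]` in `⟨dilogRelators⟩`: abelian propagation (`stub_abelianPropagation`) feeds the
number-field descent (`stub_numberFieldDescent`), cyclotomic combinations being algebraic.
[cite: Neumann1998, Thm. 3.2] -/
theorem stub_abelianSectorTorsion_of_milnor :
    Borel1977_blochGroup_regulator_kernel_torsion → Borel1977_blochGroup_rank_le →
    ∀ (N : ℕ) [NeZero N],
      (∀ m : ZMod N → ℤ, (∀ c, m c ≠ 0 → IsUnit c ∧ 0 < c.val ∧ 2 * c.val < N) →
          ∑ c : ZMod N, (m c : ℝ) *
              blochWignerDilog (Complex.exp (2 * Real.pi * Complex.I / N) ^ c.val) = 0 →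
            ∀ c, m c = 0) →
      ∀ (k : ℕ) (z : Fin k → ℂ) (n : Fin k → ℤ) (q : Fin k → Fin N → ℚ),
        (∀ i, z i =
            ∑ m : Fin N, (q i m : ℂ) * Complex.exp (2 * Real.pi * Complex.I / N) ^ (m : ℕ)) →
        (∀ i, 0 < (z i).im) →
        (∀ u v : Additive ℂˣ →+ ℚ, dehn u v (∑ i, n i • FreeAbelianGroup.of (z i)) = 0) →
        ∑ i, (n i : ℝ) * blochWignerDilog (z i) = 0 →
          ∃ M : ℕ, 0 < M ∧
            M • (∑ i, n i • FreeAbelianGroup.of (z i)) ∈ AddSubgroup.closure dilogRelators := by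
  intro hK hR N _ hMil k z n q hz him hdehn hsum
  have halg : ∀ i, IsAlgebraic ℚ (z i) := fun i => by
    rw [hz i]
    exact isAlgebraic_cyclotomicSum N (q i)
  exact stub_numberFieldDescent hK k z n halg him hdehn
    (stub_abelianPropagation hR N hMil k z n q hz him hdehn hsum)

end Summit.KontsevichZagierPeriods.HyperbolicBloch.ZagierDilogarithmCyclotomic

end
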